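import Summits.CriticalPhenomena.PercolationContinuityZ3.Theorems.PercNearOneGluingNoHeavyLowerTailCILPendantPeeling
import HarnessLib

/-!
# QUANT lane R8, front "FAR beyond trees", layer one — the EXIT LEMMA: a relay pendant at a relay forces two reached relays

builds on p205010 (kernel theorem, internal audit signed; external expert review pending)

Support file (`--supports stmt-CriticalPhenomena-4575`), seat `prim-quant-p1` (gen 18); memo
`run/shared/lean/prim/quant/prim-quant-p1-g18/FOR-LEAD-UNICYCLIC-TREES.md` §3 (i) (kernel plan §6, file F-C ingredient (ii)).
Standard axioms; no sorries; no definitions.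

* `Quant.Bundle.reachable_of_pendant_reachable` — if every open non-diagonal pair at `ℓ` is `s(ℓ,c)`, an open path from `o ≠ ℓ` to `ℓ` ends with
  that pair, so `o ↔ c`.
* **`Quant.Bundle.real_openConn_le_two_le_of_pendant_relay`** — if the relay `ℓ ∈ A` is pendant at another relay `c ∈ A` (all other pairs at `ℓ`
  have weight `0`) and `o ≠ ℓ`, then `P(o ↔ ℓ) ≤ P(#{a ∈ A : o ↔ a} ≥ 2)`: the layer-one FAR conclusion `P(N ≤ 1) ≤ max_a P(o ↮ a)` holds on the
  spot (`real_card_le_one_le_of_pendant_relay`).  This is the EXIT of the flattening algorithm (a relay below a relay), complementing the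
  bundle step `Bundle.real_card_le_one_le_of_wDet` (`…QuantFarBundleStep`).
[cite: Grimmett1999, §1.3 p. 10] (product measure, open paths); [this work].
-/

noncomputable section

namespace Summit.CriticalPhenomena.PercolationContinuityZ3.Theorems

namespace Quant

namespace Bundle

open Finset MeasureTheory Set
open Literature.Probability.LatticeModels
open Literature.Probability.Percolation
open scoped Classical

variable {n : ℕ}

/-- If every open non-diagonal pair at `ℓ` is `s(ℓ, c)`, then `o ↔ ℓ` with `o ≠ ℓ` forces `o ↔ c` (the last pair of the path). [this work] -/
theorem reachable_of_pendant_reachable {η : BondConfig (Fin n)} {o ℓ c : Fin n} (hoℓ : o ≠ ℓ)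
    (hη : ∀ x : Fin n, x ≠ ℓ → s(ℓ, x) ∈ η → x = c) (h : (openGraph η).Reachable o ℓ) : (openGraph η).Reachable o c := by
  obtain ⟨q⟩ := h.symm
  cases q with
  | nil => exact absurd rfl hoℓ
  | cons hadj q' =>
    rename_i x
    rw [openGraph_adj] at hadj
    have hx : x = c := hη x (Ne.symm hadj.2) hadj.1
    subst hx
    exact ⟨q'.reverse⟩

/-- **Exit lemma.**  If the relay `ℓ ∈ A` is pendant at the relay `c ∈ A` (`w s(ℓ,x) = 0` for `x ∉ {ℓ, c}`), `ℓ ≠ c`, `o ≠ ℓ`, then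
`P(o ↔ ℓ) ≤ P(#{a ∈ A : o ↔ a} ≥ 2)`. [this work] -/
theorem real_openConn_le_two_le_of_pendant_relay (w : Sym2 (Fin n) → unitInterval) (A : Finset (Fin n)) {o ℓ c : Fin n}
    (hℓA : ℓ ∈ A) (hcA : c ∈ A) (hℓc : ℓ ≠ c) (hoℓ : o ≠ ℓ) (hpend : ∀ x : Fin n, x ≠ ℓ → x ≠ c → w s(ℓ, x) = 0) :
    (prodBernoulli w).real (openConn o ℓ) ≤
      (prodBernoulli w).real {ω : BondConfig (Fin n) | 2 ≤ (A.filter fun a => ω ∈ openConn o a).card} := by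
  rw [PendantPeeling.measureReal_eq_inter_support w (openConn o ℓ),
    PendantPeeling.measureReal_eq_inter_support w {ω : BondConfig (Fin n) | 2 ≤ (A.filter fun a => ω ∈ openConn o a).card}]
  refine measureReal_mono fun ω hω => ?_
  simp only [mem_setOf_eq] at hω ⊢
  set η : BondConfig (Fin n) := ω ∩ {e | w e ≠ 0} with hη
  have hηℓ : ∀ x : Fin n, x ≠ ℓ → s(ℓ, x) ∈ η → x = c := by
    intro x hx hmem
    by_contra hxc
    exact hmem.2 (hpend x hx hxc)
  have hreach : (openGraph η).Reachable o ℓ := hω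
  have hc : (openGraph η).Reachable o c := reachable_of_pendant_reachable hoℓ hηℓ hreach
  have hsub : ({ℓ, c} : Finset (Fin n)) ⊆ A.filter fun a => η ∈ openConn o a := by
    intro a ha
    rcases Finset.mem_insert.1 ha with rfl | ha
    · exact mem_filter.2 ⟨hℓA, hreach⟩
    · rw [Finset.mem_singleton] at ha; subst ha
      exact mem_filter.2 ⟨hcA, hc⟩
  calc 2 = ({ℓ, c} : Finset (Fin n)).card := by rw [card_pair hℓc]
    _ ≤ _ := card_le_card hsub

/-- **Layer-one FAR on the spot**: under the hypotheses of the exit lemma, if `P(o ↮ a) ≤ t` for all `a ∈ A` then `P(N ≤ 1) ≤ t`. [this work] -/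
theorem real_card_le_one_le_of_pendant_relay (w : Sym2 (Fin n) → unitInterval) (A : Finset (Fin n)) {o ℓ c : Fin n}
    (hℓA : ℓ ∈ A) (hcA : c ∈ A) (hℓc : ℓ ≠ c) (hoℓ : o ≠ ℓ) (hpend : ∀ x : Fin n, x ≠ ℓ → x ≠ c → w s(ℓ, x) = 0) (t : ℝ)
    (hcut : ∀ a ∈ A, (prodBernoulli w).real (openConn o a : Set (BondConfig (Fin n)))ᶜ ≤ t) :
    (prodBernoulli w).real {ω : BondConfig (Fin n) | (A.filter fun a => ω ∈ openConn o a).card ≤ 1} ≤ t := by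
  have hmeas : ∀ U : Set (BondConfig (Fin n)), MeasurableSet U := fun U => (Set.toFinite U).measurableSet
  have hcomp : {ω : BondConfig (Fin n) | (A.filter fun a => ω ∈ openConn o a).card ≤ 1} =
      {ω : BondConfig (Fin n) | 2 ≤ (A.filter fun a => ω ∈ openConn o a).card}ᶜ := by
    ext ω; simp only [mem_setOf_eq, Set.mem_compl_iff]; omega
  have h1 := real_openConn_le_two_le_of_pendant_relay w A hℓA hcA hℓc hoℓ hpend
  have h2 := hcut ℓ hℓA
  rw [probReal_compl_eq_one_sub (hmeas _)] at h2
  rw [hcomp, probReal_compl_eq_one_sub (hmeas _)]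
  linarith

end Bundle

end Quant

end Summit.CriticalPhenomena.PercolationContinuityZ3.Theorems
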